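import Mathlib.Geometry.Manifold.PartitionOfUnity
import Mathlib.Geometry.Manifold.ContMDiff.NormedSpace
import Mathlib.Analysis.SpecialFunctions.SmoothTransition
import Mathlib.Analysis.SpecialFunctions.Sqrt
import Mathlib.Analysis.Calculus.Deriv.Basic
import Mathlib.Topology.MetricSpace.HausdorffDistance
import HarnessLib

/-!
# The space–time cut-offs of Cheskidov–Luo 2022, §4.3: the time cut-off `θ` and the divisor profile

A. Cheskidov, X. Luo, *Sharp nonuniqueness for the Navier–Stokes equations*, Invent. Math. 229
(2022) = arXiv:2009.06596, §4.3 "Space-time cutoffs", introduce two cut-offs before defining the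
velocity perturbation: a smooth function `χ` of the stress with `χ(x) = 1` for `|x| ≤ 1`,
`χ(x) = |x|` for `|x| ≥ 2` ((4.9)), through which the divisor `ρ = χ(R̄)` keeps `Id - R̄/ρ` in the
domain of the geometric lemma ((4.10)), and a temporal cut-off `θ ∈ C_c^∞(ℝ)` with `θ = 1` where
`dist(t, Iᶜ) ≥ 3τ/2` and `θ = 0` where `dist(t, Iᶜ) ≤ τ` ((4.11)), "which ensures that the new
solution will still be well-prepared". This file PROVES the existence/properties of both, in the
form the assembly of Prop. 4.1 (`Torus.CheskidovLuo2022ConvexIntegration`) consumes: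

* `CL22.exists_contDiff_zero_one_of_isClosed` — smooth Urysohn on `ℝ` (Mathlib's manifold
  partition of unity specialised to `M = ℝ`), and `CL22.exists_timeCutoff` — the cut-off `θ` of
  (4.11) for any set `I` and `τ > 0`, INCLUDING `θ' = 0` on `{dist(t, Iᶜ) ≤ τ}`
  (`CL22.deriv_eq_zero_of_eqOn_thickening`: a differentiable function vanishing on a closed
  `τ`-thickening has vanishing derivative there — at points at distance exactly `τ` one uses the
  segment towards a nearest point), which is what makes `∂ₜ` of the amplitudes vanish near `Iᶜ`;
* `CL22.divisorProfile` — the profile `F(s) = 1 + S((s-1)/3)(√s - 1)` (`S` = Mathlib's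
  `Real.smoothTransition`): smooth, `F = 1` on `(-∞, 1]`, `F = √s` on `[4, ∞)`, `1 ≤ F ≤ 1 + √s`,
  `√s ≤ 2F(s)`. Applied to `s = |R̄|²/γ²` it plays the role of `χ` (with a floor `γ`, see the
  docstring of `Torus.CheskidovLuo2022ConvexIntegration` in `NavierStokesReynoldsSteps` for why a
  floor is needed).

## References

* A. Cheskidov, X. Luo, Invent. Math. 229 (2022) = arXiv:2009.06596, §4.3 (4.9)–(4.11).
  [`CheskidovLuo2022`]
-/

noncomputable section

open Set Filter Topology Function Metric
open scoped ContDiff Manifold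

namespace Literature.Analysis.FluidPDE

namespace CL22

/-! ## Smooth zero–one functions on `ℝ` -/

/-- **Smooth Urysohn on `ℝ`**: disjoint closed sets are separated by a `C^∞` function with values
in `[0, 1]` (Mathlib's manifold partition of unity, `M = ℝ`). [folklore] -/
theorem exists_contDiff_zero_one_of_isClosed {s t : Set ℝ} (hs : IsClosed s) (ht : IsClosed t)
    (hd : Disjoint s t) :
    ∃ θ : ℝ → ℝ, ContDiff ℝ ∞ θ ∧ EqOn θ 0 s ∧ EqOn θ 1 t ∧ ∀ x, θ x ∈ Icc (0 : ℝ) 1 := by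
  obtain ⟨f, h0, h1, h01⟩ := exists_contMDiffMap_zero_one_of_isClosed (I := 𝓘(ℝ, ℝ)) (n := (⊤ : ℕ∞)) hs ht hd
  refine ⟨f, ?_, h0, h1, h01⟩
  have := f.contMDiff
  rw [contMDiff_iff_contDiff] at this
  exact_mod_cast this

/-! ## The time cut-off `θ` of CL22 §4.3 (4.11) -/

/-- If a differentiable function vanishes on the closed `τ`-neighbourhood `{t | infDist t A ≤ τ}`,
`τ > 0`, of a set `A ⊆ ℝ`, then so does its derivative (interior points: locally zero; points at
distance exactly `τ`: zero on the segment towards a nearest point of `closure A`). [folklore] -/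
theorem deriv_eq_zero_of_eqOn_thickening {θ : ℝ → ℝ} (hθ : Differentiable ℝ θ) {A : Set ℝ} {τ : ℝ} (hτ : 0 < τ)
    (h0 : ∀ t, infDist t A ≤ τ → θ t = 0) {t : ℝ} (ht : infDist t A ≤ τ) : deriv θ t = 0 := by
  rcases ht.lt_or_eq with hlt | heq
  · -- interior point: `θ` vanishes near `t`
    have hev : θ =ᶠ[𝓝 t] fun _ => 0 := by
      have : ∀ᶠ t' in 𝓝 t, infDist t' A < τ :=
        (continuous_infDist_pt A).continuousAt.eventually (gt_mem_nhds hlt)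
      exact this.mono fun t' ht' => h0 t' ht'.le
    rw [hev.deriv_eq, deriv_const]
  · -- boundary point: a nearest point `p` of `closure A` exists and `θ = 0` on the segment `[t, p]`
    have hne : (closure A).Nonempty := by
      by_contra hA
      rw [not_nonempty_iff_eq_empty, closure_empty_iff] at hA
      rw [hA, infDist_empty] at heq
      linarith
    obtain ⟨p, hp, hdist⟩ := isClosed_closure.exists_infDist_eq_dist hne t
    rw [infDist_closure] at hdist
    -- `θ = 0` on the closed segment between `t` and `p`
    have hseg : ∀ t' ∈ uIcc t p, θ t' = 0 := by
      intro t' ht'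
      refine h0 t' ?_
      calc infDist t' A = infDist t' (closure A) := (infDist_closure).symm
        _ ≤ dist t' p := infDist_le_dist_of_mem hp
        _ ≤ dist t p := by
            rw [Real.dist_eq, Real.dist_eq]
            rcases mem_uIcc.1 ht' with ⟨h1, h2⟩ | ⟨h1, h2⟩
            · rw [abs_of_nonpos (by linarith), abs_of_nonpos (by linarith)]; linarith
            · rw [abs_of_nonneg (by linarith), abs_of_nonneg (by linarith)]; linarith
        _ = τ := by rw [← hdist, heq]
    have htp : t ≠ p := by
      intro h
      rw [← h] at hdist
      rw [dist_self] at hdist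
      linarith
    -- derivative within the segment is zero, and equals the derivative
    have hud : UniqueDiffWithinAt ℝ (uIcc t p) t :=
      uniqueDiffOn_Icc (by rcases lt_or_gt_of_ne htp with h | h <;> simp [h.le, h]) t left_mem_uIcc
    have h1 : derivWithin θ (uIcc t p) t = deriv θ t := (hθ t).derivWithin hud
    have h2 : derivWithin θ (uIcc t p) t = 0 := by
      rw [derivWithin_congr (f := fun _ => (0 : ℝ)) (fun t' ht' => hseg t' ht') (hseg t left_mem_uIcc)]
      rw [derivWithin_fun_const]
      rfl
    rw [← h1, h2]

/-- **The time cut-off of CL22 §4.3 (4.11)**: for a set `I ⊆ ℝ` and `τ > 0` there is `θ ∈ C^∞(ℝ)`,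
`0 ≤ θ ≤ 1`, with `θ(t) = 0` if `dist(t, Iᶜ) ≤ τ` and `θ(t) = 1` if `dist(t, Iᶜ) ≥ 3τ/2`; moreover
`θ' = 0` wherever `dist(t, Iᶜ) ≤ τ` ("this cutoff ensures that the new solution will still be
well-prepared"). [cite: CheskidovLuo2022, §4.3 (4.11)] -/
theorem exists_timeCutoff (I : Set ℝ) {τ : ℝ} (hτ : 0 < τ) :
    ∃ θ : ℝ → ℝ, ContDiff ℝ ∞ θ ∧ (∀ t, θ t ∈ Icc (0 : ℝ) 1) ∧
      (∀ t, infDist t Iᶜ ≤ τ → θ t = 0) ∧ (∀ t, 3 * τ / 2 ≤ infDist t Iᶜ → θ t = 1) ∧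
      ∀ t, infDist t Iᶜ ≤ τ → deriv θ t = 0 := by
  have hs : IsClosed {t : ℝ | infDist t Iᶜ ≤ τ} := isClosed_le (continuous_infDist_pt _) continuous_const
  have ht : IsClosed {t : ℝ | 3 * τ / 2 ≤ infDist t Iᶜ} := isClosed_le continuous_const (continuous_infDist_pt _)
  have hd : Disjoint {t : ℝ | infDist t Iᶜ ≤ τ} {t : ℝ | 3 * τ / 2 ≤ infDist t Iᶜ} := by
    rw [Set.disjoint_left]
    intro t h1 h2
    simp only [mem_setOf_eq] at h1 h2
    linarith
  obtain ⟨θ, hθ, h0, h1, h01⟩ := exists_contDiff_zero_one_of_isClosed hs ht hd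
  refine ⟨θ, hθ, h01, fun t ht => h0 ht, fun t ht => h1 ht, fun t ht => ?_⟩
  exact deriv_eq_zero_of_eqOn_thickening (hθ.differentiable (by simp)) hτ (fun t ht => h0 ht) ht

/-! ## The divisor profile: `F = 1` on `(-∞, 1]`, `F = √·` on `[4, ∞)` -/

/-- The divisor profile `F(s) = 1 + S((s-1)/3) (√s - 1)`, `S` Mathlib's `Real.smoothTransition`:
a smooth interpolation between `1` (for `s ≤ 1`) and `√s` (for `s ≥ 4`). It replaces the cut-off
`χ` of CL22 §4.3 (4.9) (`χ(x) = 1` for `|x| ≤ 1`, `= |x|` for `|x| ≥ 2`), applied to `s = |x|²`. [cite: CheskidovLuo2022, §4.3 (4.9)] -/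
def divisorProfile (s : ℝ) : ℝ := 1 + Real.smoothTransition ((s - 1) / 3) * (Real.sqrt s - 1)

/-- `F = 1` on `(-∞, 1]`. [folklore] -/
theorem divisorProfile_of_le_one {s : ℝ} (hs : s ≤ 1) : divisorProfile s = 1 := by
  rw [divisorProfile, Real.smoothTransition.zero_of_nonpos (by linarith [div_nonpos_of_nonpos_of_nonneg (by linarith : s - 1 ≤ 0) (by norm_num : (0:ℝ) ≤ 3)])]
  ring

/-- `F = √·` on `[4, ∞)`. [folklore] -/
theorem divisorProfile_of_four_le {s : ℝ} (hs : 4 ≤ s) : divisorProfile s = Real.sqrt s := by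
  rw [divisorProfile, Real.smoothTransition.one_of_one_le (by rw [le_div_iff₀ (by norm_num)]; linarith)]
  ring

/-- `1 ≤ F`. [folklore] -/
theorem one_le_divisorProfile (s : ℝ) : 1 ≤ divisorProfile s := by
  rw [divisorProfile]
  have h0 := Real.smoothTransition.nonneg ((s - 1) / 3)
  have h1 := Real.smoothTransition.le_one ((s - 1) / 3)
  rcases le_or_gt s 1 with hs | hs
  · rw [Real.smoothTransition.zero_of_nonpos (by linarith [div_nonpos_of_nonpos_of_nonneg (by linarith : s - 1 ≤ 0) (by norm_num : (0:ℝ) ≤ 3)])]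
    linarith
  · have : 1 ≤ Real.sqrt s := by rw [← Real.sqrt_one]; exact Real.sqrt_le_sqrt hs.le
    nlinarith

/-- `F ≤ 1 + √s`. [folklore] -/
theorem divisorProfile_le (s : ℝ) : divisorProfile s ≤ 1 + Real.sqrt s := by
  rw [divisorProfile]
  have h0 := Real.smoothTransition.nonneg ((s - 1) / 3)
  have h1 := Real.smoothTransition.le_one ((s - 1) / 3)
  have hs := Real.sqrt_nonneg s
  rcases le_or_gt (Real.sqrt s) 1 with h | h
  · nlinarith
  · nlinarith

/-- `√s ≤ 2 F(s)`. [folklore] -/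
theorem sqrt_le_two_mul_divisorProfile (s : ℝ) : Real.sqrt s ≤ 2 * divisorProfile s := by
  rcases le_or_gt 4 s with hs | hs
  · rw [divisorProfile_of_four_le hs]; linarith [Real.sqrt_nonneg s]
  · have : Real.sqrt s ≤ 2 := by
      rw [show (2 : ℝ) = Real.sqrt 4 by rw [show (4:ℝ) = 2 ^ 2 by norm_num, Real.sqrt_sq (by norm_num)]]
      exact Real.sqrt_le_sqrt hs.le
    linarith [one_le_divisorProfile s]

/-- `F` is smooth (near `s ≤ 1` it is constant; on `s > 0` it is a product of smooth functions). [folklore] -/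
theorem contDiff_divisorProfile : ContDiff ℝ ∞ divisorProfile := by
  refine contDiff_iff_contDiffAt.2 fun s => ?_
  rcases lt_or_ge s 1 with hs | hs
  · -- locally constant `= 1`
    have hev : divisorProfile =ᶠ[𝓝 s] fun _ => 1 :=
      (eventually_lt_nhds hs).mono fun s' hs' => divisorProfile_of_le_one hs'.le
    exact contDiffAt_const.congr_of_eventuallyEq hev
  · have hs0 : s ≠ 0 := by linarith
    unfold divisorProfile
    refine contDiffAt_const.add (ContDiffAt.mul ?_ ((Real.contDiffAt_sqrt hs0).sub contDiffAt_const))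
    exact Real.smoothTransition.contDiff.contDiffAt.comp s ((contDiffAt_id.sub contDiffAt_const).div_const 3)

end CL22

end Literature.Analysis.FluidPDE
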